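import Literature.AlgebraicGeometry.Resolution.ExceptionalDivisorLocallyTrivial
import Literature.AlgebraicGeometry.Resolution.BlowupSmoothProjective
import Summits.HodgeConjecture.HodgeConjecture.Theorems.BoundaryReadoutPullbackAlgebraicBundlePullback
import Summits.HodgeConjecture.HodgeConjecture.Theorems.BoundaryReadoutPullbackAlgebraicDeformationDatum
import HarnessLib

/-!
# Granted its Zariski-local triviality, the exceptional divisor of the blowing up of a smooth
# projective variety along a smooth closed subvariety is smooth projective of dimension `dim Z + r`

Route `BoundaryReadout` / `QbarEnvelope` of `HodgeConjecture`, crux `PullbackAlgebraic`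
(stmt-HodgeConjecture-1071), line `normal_cone`, stub `stub_exceptionalDivisorSmoothProjective`.

Let `i : Z ⟶ V` be a closed `ℂ`-immersion of smooth projective complex varieties of dimensions
`m` and `m + r + 1`, and let `β : B ⟶ V` be any blowing up of `V` along `ker i` (`IsBlowup`). The
exceptional divisor is `E = B ×_V Z` with its projection `q = pr₂ : E → Z`; as a `ℂ`-scheme its
structure morphism is `q ≫ (Z → Spec ℂ)`. GRANTED the named fact
`Resolution.Hartshorne1977_exceptionalDivisor_locallyTrivial` (Hartshorne II Thm. 8.24 (b) with
II Thm. 8.17: `q` is, Zariski-locally over `Z`, isomorphic over `Z` to `U × ℙʳ → U`), we prove that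
`E` is a smooth projective variety of dimension `m + r`:

* smooth of relative dimension `m + r` over `ℂ`: `q` is smooth of relative dimension `r`, because
  this property is Zariski-local on the target and over a trivialising `U` the restriction `q ∣_ U`
  is an isomorphism followed by the projection `U ⊗ ℙʳ → U`, a base change of the structure
  morphism of `ℙʳ_ℂ`, which is smooth of relative dimension `r`; then compose with `Z → Spec ℂ`
  (smooth of relative dimension `m`);
* projective: `pr₁ : E → B` is a closed immersion (base change of `i`) and `B` is projective
  (`IsBlowup.isSmoothProjective`: the centre `V(ker i) ≅ Z` is regular and `ker i ≠ ⊥` because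
  `dim Z = m ≠ m + r + 1 = dim V` forbids `i` from being surjective);
* geometrically irreducible: `q` is geometrically irreducible (again Zariski-local on the target,
  and `U ⊗ ℙʳ → U` is a base change of the geometrically irreducible `ℙʳ_ℂ → Spec ℂ`) and smooth,
  hence universally open; `Z → Spec ℂ` is geometrically irreducible and universally open; and
  geometric irreducibility is stable under such compositions (Mathlib
  `GeometricallyIrreducible.comp`).

## References

* [Hartshorne1977] R. Hartshorne, Algebraic Geometry, GTM 52 (1977), II Thm. 8.24 (b), II Thm. 8.17,
  III Prop. 10.1.
* [Fulton1998] W. Fulton, Intersection Theory, 2nd ed. (1998), App. B.6.9.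
* [StacksProject] The Stacks Project, Tags 01V4 (smooth morphisms: local on the target, stable
  under base change and composition), 0366 (geometrically irreducible schemes).
-/

noncomputable section

-- `Summit.HodgeConjecture.HodgeConjecture.…` is the mandated namespace (single-conjunct summit).
set_option linter.dupNamespace false

namespace Summit.HodgeConjecture.HodgeConjecture.Theorems.PullbackAlgebraicNormalCone

open CategoryTheory CategoryTheory.Limits AlgebraicGeometry MonoidalCategory CartesianMonoidalCategory
open Literature.AlgebraicGeometry Literature.AlgebraicGeometry.Motives Literature.AlgebraicGeometry.Resolution
open Literature.AlgebraicGeometry.HodgeTheory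

namespace ExceptionalDivisorSmoothProjective

/-- **A property of morphisms which is Zariski-local on the target and holds for the projections
`U ⊗ ℙʳ_ℂ → U` holds for every Zariski-locally trivial `ℙʳ`-bundle.** If every point of `X` has an
open neighbourhood `U` over which `q : E → X` is isomorphic, over `U`, to `U ⊗ ℙʳ_ℂ → U`, then
`q ∣_ U` is that isomorphism followed by the projection, so `P (q ∣_ U)`; conclude by locality.
(The pattern of `BundlePullback.flat_left_of_locallyTrivial`.) [folklore] -/
theorem of_locallyTrivial {P : MorphismProperty Scheme.{0}} [IsZariskiLocalAtTarget P] {r : ℕ}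
    {X : SchemeOver ℂ} {E : Scheme.{0}} (q : E ⟶ X.left)
    (htriv : ∀ x : X.left, ∃ U : X.left.Opens, x ∈ U ∧
      ∃ ψ : (Over.mk ((q ⁻¹ᵁ U).ι ≫ q ≫ X.hom) : SchemeOver ℂ) ≅
          (Over.mk (U.ι ≫ X.hom) : SchemeOver ℂ) ⊗ projectiveSpace r ℂ,
        ψ.hom.left ≫ (fst (Over.mk (U.ι ≫ X.hom) : SchemeOver ℂ) (projectiveSpace r ℂ)).left ≫ U.ι =
          (q ⁻¹ᵁ U).ι ≫ q)
    (hP : ∀ U : X.left.Opens,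
      P (fst (Over.mk (U.ι ≫ X.hom) : SchemeOver ℂ) (projectiveSpace r ℂ)).left) :
    P q := by
  refine IsZariskiLocalAtTarget.of_forall_exists_morphismRestrict (P := P) fun x ↦ ?_
  obtain ⟨U, hxU, ψ, hψ⟩ := htriv x
  refine ⟨U, hxU, ?_⟩
  -- `ψ ≫ pr_U` satisfies `P`: `ψ` is an isomorphism and `pr_U` satisfies `P`
  have hP' : P (ψ.hom.left ≫
      (fst (Over.mk (U.ι ≫ X.hom) : SchemeOver ℂ) (projectiveSpace r ℂ)).left) :=
    (P.cancel_left_of_respectsIso _ _).2 (hP U)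
  -- and it is `q ∣_ U`, both having the same composite with the monomorphism `U.ι`
  have hψ' : q ∣_ U ≫ U.ι =
      (ψ.hom.left ≫ (fst (Over.mk (U.ι ≫ X.hom) : SchemeOver ℂ) (projectiveSpace r ℂ)).left :
        (q ⁻¹ᵁ U : Scheme) ⟶ (U : Scheme)) ≫ U.ι := by
    simp only [Category.assoc, morphismRestrict_ι]
    exact hψ.symm
  rw [(cancel_mono U.ι).mp hψ']
  exact hP'

/-- The projection `U ⊗ ℙʳ_ℂ → U` is smooth of relative dimension `r`: a base change of the
structure morphism `ℙʳ_ℂ → Spec ℂ`. [cite: Hartshorne1977, III Prop. 10.1] -/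
theorem smoothOfRelativeDimension_fst_projectiveSpace (r : ℕ) (W : SchemeOver ℂ) :
    SmoothOfRelativeDimension r (fst W (projectiveSpace r ℂ)).left := by
  change SmoothOfRelativeDimension r (pullback.fst W.hom (projectiveSpace r ℂ).hom)
  haveI := smoothOfRelativeDimension_isStableUnderBaseChange r
  exact MorphismProperty.pullback_fst _ _
    (isSmoothProjective_projectiveSpace_holds ℂ r).smoothOfRelativeDimension

/-- The projection `U ⊗ ℙʳ_ℂ → U` is geometrically irreducible: a base change of the
geometrically irreducible `ℙʳ_ℂ → Spec ℂ`. [cite: StacksProject, Tag 0366] -/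
theorem geometricallyIrreducible_fst_projectiveSpace (r : ℕ) (W : SchemeOver ℂ) :
    GeometricallyIrreducible (fst W (projectiveSpace r ℂ)).left := by
  change GeometricallyIrreducible (pullback.fst W.hom (projectiveSpace r ℂ).hom)
  haveI := (isSmoothProjective_projectiveSpace_holds ℂ r).geometricallyIrreducible
  infer_instance

/-- A Zariski-locally trivial `ℙʳ`-bundle is smooth of relative dimension `r`.
[cite: Hartshorne1977, III Prop. 10.1] -/
theorem smoothOfRelativeDimension_of_locallyTrivial {r : ℕ} {X : SchemeOver ℂ} {E : Scheme.{0}}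
    (q : E ⟶ X.left)
    (htriv : ∀ x : X.left, ∃ U : X.left.Opens, x ∈ U ∧
      ∃ ψ : (Over.mk ((q ⁻¹ᵁ U).ι ≫ q ≫ X.hom) : SchemeOver ℂ) ≅
          (Over.mk (U.ι ≫ X.hom) : SchemeOver ℂ) ⊗ projectiveSpace r ℂ,
        ψ.hom.left ≫ (fst (Over.mk (U.ι ≫ X.hom) : SchemeOver ℂ) (projectiveSpace r ℂ)).left ≫ U.ι =
          (q ⁻¹ᵁ U).ι ≫ q) :
    SmoothOfRelativeDimension r q :=
  of_locallyTrivial (P := @SmoothOfRelativeDimension r) q htriv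
    fun _ ↦ smoothOfRelativeDimension_fst_projectiveSpace r _

/-- A Zariski-locally trivial `ℙʳ`-bundle is geometrically irreducible (as a morphism).
[cite: StacksProject, Tag 0366] -/
theorem geometricallyIrreducible_of_locallyTrivial {r : ℕ} {X : SchemeOver ℂ} {E : Scheme.{0}}
    (q : E ⟶ X.left)
    (htriv : ∀ x : X.left, ∃ U : X.left.Opens, x ∈ U ∧
      ∃ ψ : (Over.mk ((q ⁻¹ᵁ U).ι ≫ q ≫ X.hom) : SchemeOver ℂ) ≅
          (Over.mk (U.ι ≫ X.hom) : SchemeOver ℂ) ⊗ projectiveSpace r ℂ,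
        ψ.hom.left ≫ (fst (Over.mk (U.ι ≫ X.hom) : SchemeOver ℂ) (projectiveSpace r ℂ)).left ≫ U.ι =
          (q ⁻¹ᵁ U).ι ≫ q) :
    GeometricallyIrreducible q :=
  haveI : IsZariskiLocalAtTarget @GeometricallyIrreducible :=
    GeometricallyIrreducible.eq_geometrically ▸ inferInstance
  of_locallyTrivial (P := @GeometricallyIrreducible) q htriv
    fun _ ↦ geometricallyIrreducible_fst_projectiveSpace r _

/-- A smooth morphism which is geometrically irreducible, composed with the structure morphism of
a smooth geometrically irreducible `k`-scheme, is geometrically irreducible (smooth morphisms are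
universally open; Mathlib `GeometricallyIrreducible.comp`). [folklore] -/
theorem geometricallyIrreducible_comp_of_smooth {n r : ℕ} {X : SchemeOver ℂ} {E : Scheme.{0}}
    (q : E ⟶ X.left) [SmoothOfRelativeDimension r q] [GeometricallyIrreducible q]
    (hX : IsSmoothProjective n X) : GeometricallyIrreducible (q ≫ X.hom) := by
  haveI := hX.smoothOfRelativeDimension
  haveI := hX.geometricallyIrreducible
  haveI : Smooth X.hom := SmoothOfRelativeDimension.smooth n X.hom
  haveI : Smooth q := SmoothOfRelativeDimension.smooth r q
  exact GeometricallyIrreducible.comp q X.hom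

/-- A closed immersion between smooth projective varieties of different dimensions is not
surjective (else it would be a homeomorphism, and the dimension of a smooth projective variety of
relative dimension `n` is `n`). [cite: Hartshorne1977, II Ex. 3.20 and III.10] -/
theorem range_ne_univ_of_isSmoothProjective {m n : ℕ} {Z V : SchemeOver ℂ} (i : Z ⟶ V)
    [IsClosedImmersion i.left] (hZ : IsSmoothProjective m Z) (hV : IsSmoothProjective n V)
    (hmn : m ≠ n) : Set.range i.left ≠ Set.univ := by
  intro huniv
  have hf : IsHomeomorph i.left.base :=
    (isHomeomorph_iff_isEmbedding_surjective (f := i.left.base)).2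
      ⟨i.left.isClosedEmbedding.isEmbedding, Set.range_eq_univ.1 huniv⟩
  have h₁ := schemeDim_eq_holds hZ
  have h₂ := schemeDim_eq_holds hV
  unfold schemeDim at h₁ h₂
  rw [hf.topologicalKrullDim_eq] at h₁
  exact hmn (h₁.symm.trans h₂)

end ExceptionalDivisorSmoothProjective

open ExceptionalDivisorSmoothProjective in
/-- **Granted its Zariski-local triviality, the exceptional divisor is a smooth projective variety
of dimension `dim Z + r`** (Hartshorne II 8.24 (b); Fulton 1998 B.6.9): for `i : Z ⟶ V` a closed
immersion of smooth projective complex varieties of dimensions `m`, `m + r + 1` and any blowing up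
`β : B ⟶ V` along `ker i`, the `ℂ`-scheme `E = B ×_V Z` (structure map through `pr₂` and `Z`) is
smooth projective of dimension `m + r`: smooth of relative dimension `r` over `Z` (locally
`U × ℙʳ`), hence of relative dimension `m + r` over `ℂ`; projective as a closed subscheme (`pr₁`,
base change of the closed immersion `i`) of `B`, which is projective
(`IsBlowup.isSmoothProjective`); geometrically irreducible because `pr₂` is geometrically
irreducible (locally a base change of `ℙʳ_ℂ → Spec ℂ`) and smooth, hence universally open, over
the geometrically irreducible `Z`. [cite: Hartshorne1977, II Thm. 8.24 (b)]
[cite: Fulton1998, App. B.6.9] -/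
theorem stub_exceptionalDivisorSmoothProjective :
    Hartshorne1977_exceptionalDivisor_locallyTrivial.{0} →
    ∀ ⦃m r : ℕ⦄ ⦃V Z B : SchemeOver ℂ⦄ (i : Z ⟶ V) (β : B ⟶ V),
      IsSmoothProjective (m + r + 1) V → IsSmoothProjective m Z → IsClosedImmersion i.left →
      IsBlowup β.left i.left.ker →
      IsSmoothProjective (m + r) (Over.mk (pullback.snd β.left i.left ≫ Z.hom) : SchemeOver ℂ) := by
  intro hα m r V Z B i β hV hZ hi hβ
  haveI := hi
  -- the named fact: `q = pr₂ : E → Z` is Zariski-locally over `Z` the projection `U ⊗ ℙʳ → U`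
  have htriv := hα ℂ i β hV hZ hi hβ
  -- (1) smooth of relative dimension `r + m = m + r` over `ℂ`
  haveI hq : SmoothOfRelativeDimension r (pullback.snd β.left i.left) :=
    smoothOfRelativeDimension_of_locallyTrivial (pullback.snd β.left i.left) htriv
  haveI := hZ.smoothOfRelativeDimension
  have hsm : SmoothOfRelativeDimension (m + r) (pullback.snd β.left i.left ≫ Z.hom) := by
    rw [Nat.add_comm]
    infer_instance
  -- (3) geometrically irreducible
  haveI : GeometricallyIrreducible (pullback.snd β.left i.left) :=
    geometricallyIrreducible_of_locallyTrivial (pullback.snd β.left i.left) htriv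
  have hgi : GeometricallyIrreducible (pullback.snd β.left i.left ≫ Z.hom) :=
    geometricallyIrreducible_comp_of_smooth (r := r) (pullback.snd β.left i.left) hZ
  -- (2) projective: `pr₁ : E → B` is a closed immersion into the projective blow-up `B`
  have hB : IsSmoothProjective (m + r + 1) (Over.mk (β.left ≫ V.hom) : SchemeOver ℂ) :=
    hβ.isSmoothProjective hV
      (ker_ne_bot_of_range_ne_univ i.left
        (range_ne_univ_of_isSmoothProjective i hZ hV (by omega)))
      (isRegular_ker_subscheme i.left (isRegular_of_isSmoothProjective hZ))
  let k : (Over.mk (pullback.snd β.left i.left ≫ Z.hom) : SchemeOver ℂ) ⟶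
      (Over.mk (β.left ≫ V.hom) : SchemeOver ℂ) :=
    Over.homMk (pullback.fst β.left i.left) (by
      change pullback.fst β.left i.left ≫ β.left ≫ V.hom = pullback.snd β.left i.left ≫ Z.hom
      rw [pullback.condition_assoc, Over.w i])
  haveI : IsClosedImmersion k.left :=
    inferInstanceAs (IsClosedImmersion (pullback.fst β.left i.left))
  have hproj : IsProjectiveOver (Over.mk (pullback.snd β.left i.left ≫ Z.hom) : SchemeOver ℂ) :=
    isProjectiveOver_of_isClosedImmersion_left k hB.isProjectiveOver
  exact ⟨hsm, hproj, hgi⟩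

end Summit.HodgeConjecture.HodgeConjecture.Theorems.PullbackAlgebraicNormalCone

end
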